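import Summits.HodgeConjecture.CorCM.Census.MultiFieldWeilDefect
import Summits.HodgeConjecture.CorCM.Census.SexticDecicWeilDefect
import Mathlib.Data.Fin.VecNotation
import HarnessLib

/-!
# `E × T × B₄ × B₅` over a sextic, an octic and a decic CM field sharing `k` (THREE FIELDS, degrees `6 + 8 + 10`): the data of the generic
# multi-field model and THE DEFECT LAW `d₁ ≡ t₁, d₂ ≡ t₂, d₃ ≡ t₃, e = t₁ + 2t₂ + t₃` from a realised ROTATION of the five decic pairs and JOINT
# TRANSITIVITY on the sextic and octic pairs

COR-CM (cell `pub-hodgecm2`), seat b30 gen 28 (2026-08-23); count-neutral own lane, first consumer of the MULTI-FIELD WEIL ENGINE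
(`Census/MultiFieldWeil{,Defect}`).  Theorems of the finite model plus bookkeeping definitions (`n3`, `np3`, `c3`, `w3`, `P3` — the data of the
instance); no named fact, no geometry, no `sorry`.

THE INSTANCE.  `r = 3` fields: `K₁` sextic (`n = 3` pairs, type of `k`-signature `(1,2)` read at the position set `{0}`, curve multiplicity `c = 1`,
part size `w = 2`: the FOURFOLD `T × E`), `K₂` octic (`n = 4`, `(1,3)` at `{0}`, `c = 2`, `w = 3`: the SIXFOLD `B₄ × E × E`), `K₃` decic (`n = 5`,
`(2,3)` at `{0,1}`, `c = 1`, `w = 3`: the SIXFOLD `B₅ × E`).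
THE ARGUMENT (`defect3_of_signed`).  HYPOTHESES on the realised tuples `R ⊆ Sym(3) × Sym(4) × Sym(5)` (both automatic downstream with NO Galois
hypothesis): (i) `R` is stable under right translation of the decic component by a conjugate rotation `ρ = g (+1) g⁻¹` (`hrot` — a realised 5-cycle
`σ` exists by Cauchy in the transitive decic part, gen 23, and `(π₁, π₂, σ)¹² = (1, 1, σ²)`); (ii) every pair `(x, y)` of a sextic and an octic pair
is moved to `(0, 0)` by one member (`hjt` — joint transitivity on `Fib₁ × Fib₂` for the coprime relative degrees `3, 4`, gen 26ʼs counting lemma).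
From (i) exactly as in gen 27ʼs `SexticDecicWeil.defectSD_of_signed`: the five equations at `(π₁, π₂, π₃ρʲ)` share their `e`-, `d₁`-, `d₂`-parts,
so the pair sums of `u = d₃ ∘ g` are constant along `ℤ/5`, forcing `d₃ ≡ t₃` (`SexticDecicWeil.const_of_pairSums`) and a decic part `−t₃` in EVERY
equation; from (ii) then `e + 2d₁(x) + 2d₂(y) = Σd₁ + Σd₂ + t₃` for all `(x, y)`, so `d₁ ≡ t₁`, `d₂ ≡ t₂` and `e = t₁ + 2t₂ + t₃ = Σ_m c_m t_m`.
On configurations: **`exists_hasDefectsG_of_modelBalancedG3`** — the hypothesis `hdef` of the generic headline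
`MultiFieldWeil.hodgeConjectureFor_biproduct_comp_of_defectLawG` for this instance.
[cite: Pohlmann1968, Thm 1] [cite: GaoUllmo2025, Thm 3.1] [cite: MoonenZarhin1995Duke, Thm. 2.4] [cite: DixonMortimer1996, §2.1]

## References
* [Pohlmann1968] H. Pohlmann, Ann. of Math. 88 (1968), Thm 1.  [GaoUllmo2025] Z. Gao, E. Ullmo, J. Inst. Math. Jussieu 25 (2025),
  Thm 3.1.  [MoonenZarhin1995Duke] B. Moonen, Yu. Zarhin, Duke Math. J. 77 (1995), Thm. 2.4.  [DixonMortimer1996] J. D. Dixon,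
  B. Mortimer, *Permutation Groups*, GTM 163, §2.1.
-/

namespace Summit.HodgeConjecture.CorCM.Census.SexticOcticDecicWeil

open Finset
open Summit.HodgeConjecture.CorCM.Census.MultiFieldWeil
open Summit.HodgeConjecture.CorCM.Census.SexticOcticWeil (sum_ite_perm_eq)
open Summit.HodgeConjecture.CorCM.Census.SexticDecicWeil (sum_ite_pair_eq const_of_pairSums sum_ite_rot_pow_eq)

/-! ### The data of the instance -/

/-- Numbers of conjugate pairs: `3, 4, 5` (sextic, octic, decic). [folklore] -/
def n3 : Fin 3 → ℕ := ![3, 4, 5]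

/-- Numbers of positions over `τ`: `1, 1, 2` (`k`-signatures `(1,2)`, `(1,3)`, `(2,3)`). [folklore] -/
def np3 : Fin 3 → ℕ := ![1, 1, 2]

/-- Curve multiplicities `c_m = n_m − 2 p_m`: `1, 2, 1`. [folklore] -/
def c3 : Fin 3 → ℕ := ![1, 2, 1]

/-- Part sizes `w_m = n_m − p_m`: `2, 3, 3` (the fourfold `T × E`, the sixfolds `B₄ × E²`, `B₅ × E`). [folklore] -/
def w3 : Fin 3 → ℕ := ![2, 3, 3]

/-- The position sets: the first `np3 m` positions. [folklore] -/
def P3 : ∀ m : Fin 3, Finset (Fin (n3 m)) := fun m => lowPos (n3 m) (np3 m)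

/-- `|P3 m| = np3 m`. [folklore] -/
theorem card_P3 (m : Fin 3) : (P3 m).card = np3 m := by
  refine Fin.cases ?_ (fun m => Fin.cases ?_ (fun m => Fin.cases ?_ (fun m => m.elim0) m) m) m
  · exact card_lowPos (by decide)
  · exact card_lowPos (by decide)
  · exact card_lowPos (by decide)

/-- `n_m = 2 p_m + c_m`. [folklore] -/
theorem n3_eq (m : Fin 3) : (n3 m : ℤ) = 2 * (P3 m).card + c3 m := by
  rw [card_P3]
  refine Fin.cases ?_ (fun m => Fin.cases ?_ (fun m => Fin.cases ?_ (fun m => m.elim0) m) m) m <;> rfl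

/-- `n_m + c_m = 2 w_m`. [folklore] -/
theorem n3_add_c3 (m : Fin 3) : n3 m + c3 m = 2 * w3 m := by
  refine Fin.cases ?_ (fun m => Fin.cases ?_ (fun m => Fin.cases ?_ (fun m => m.elim0) m) m) m <;> rfl

/-- `c_m < n_m`. [folklore] -/
theorem c3_lt_n3 (m : Fin 3) : c3 m < n3 m := by
  refine Fin.cases ?_ (fun m => Fin.cases ?_ (fun m => Fin.cases ?_ (fun m => m.elim0) m) m) m <;> decide

/-! ### Reading the tuples and the defects in concrete types -/

/-- The sextic component of a tuple, as a permutation of `Fin 3`. [folklore] -/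
def sx (π : PermsG n3) : Equiv.Perm (Fin 3) := π 0

/-- The octic component of a tuple, as a permutation of `Fin 4`. [folklore] -/
def oc (π : PermsG n3) : Equiv.Perm (Fin 4) := π 1

/-- The decic component of a tuple, as a permutation of `Fin 5`. [folklore] -/
def dc (π : PermsG n3) : Equiv.Perm (Fin 5) := π 2

/-- Replacing the decic component of a tuple. [folklore] -/
def withDc (π : PermsG n3) (σ : Equiv.Perm (Fin 5)) : PermsG n3 := Function.update π 2 σ

/-- `sx` is unchanged by `withDc`. [folklore] -/
@[simp] theorem sx_withDc (π : PermsG n3) (σ : Equiv.Perm (Fin 5)) : sx (withDc π σ) = sx π := by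
  unfold sx withDc
  exact Function.update_of_ne (by decide) _ _

/-- `oc` is unchanged by `withDc`. [folklore] -/
@[simp] theorem oc_withDc (π : PermsG n3) (σ : Equiv.Perm (Fin 5)) : oc (withDc π σ) = oc π := by
  unfold oc withDc
  exact Function.update_of_ne (by decide) _ _

/-- `dc (withDc π σ) = σ`. [folklore] -/
@[simp] theorem dc_withDc (π : PermsG n3) (σ : Equiv.Perm (Fin 5)) : dc (withDc π σ) = σ := by
  show Function.update π 2 _ 2 = _
  exact Function.update_self _ _ _

/-- `withDc π (dc π) = π`. [folklore] -/
@[simp] theorem withDc_dc (π : PermsG n3) : withDc π (dc π) = π := by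
  show Function.update π 2 (π 2) = π
  exact Function.update_eq_self _ _

/-- `withDc (withDc π σ) σ' = withDc π σ'`. [folklore] -/
@[simp] theorem withDc_withDc (π : PermsG n3) (σ σ' : Equiv.Perm (Fin 5)) : withDc (withDc π σ) σ' = withDc π σ' := by
  show Function.update (Function.update π 2 _) 2 _ = Function.update π 2 _
  exact Function.update_idem _ _ _

/-- The sextic defects, as a function on `Fin 3`. [folklore] -/
def rd0 (d : ∀ m : Fin 3, Fin (n3 m) → ℤ) : Fin 3 → ℤ := d 0

/-- The octic defects, as a function on `Fin 4`. [folklore] -/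
def rd1 (d : ∀ m : Fin 3, Fin (n3 m) → ℤ) : Fin 4 → ℤ := d 1

/-- The decic defects, as a function on `Fin 5`. [folklore] -/
def rd2 (d : ∀ m : Fin 3, Fin (n3 m) → ℤ) : Fin 5 → ℤ := d 2

/-- **The triple sum of the signed equation, read in concrete types**: the conditions are `sx π a = 0`, `oc π a = 0`, `dc π b ∈ {0, 1}`.
[folklore] -/
theorem sum3_eq (π : PermsG n3) (d : ∀ m : Fin 3, Fin (n3 m) → ℤ) :
    (∑ m : Fin 3, ∑ a : Fin (n3 m), (if π m a ∈ P3 m then d m a else -d m a)) =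
      (∑ a : Fin 3, (if sx π a = 0 then rd0 d a else -rd0 d a)) +
        (∑ a : Fin 4, (if oc π a = 0 then rd1 d a else -rd1 d a)) +
          ∑ b : Fin 5, (if (dc π b = 0 ∨ dc π b = 1) then rd2 d b else -rd2 d b) := by
  rw [Fin.sum_univ_three]
  have h0 : (∑ a : Fin (n3 0), (if π 0 a ∈ P3 0 then d 0 a else -d 0 a)) = ∑ a : Fin 3, (if sx π a = 0 then rd0 d a else -rd0 d a) := by
    show (∑ a : Fin 3, (if sx π a ∈ lowPos 3 1 then rd0 d a else -rd0 d a)) = _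
    exact Finset.sum_congr rfl fun a _ => if_congr mem_lowPos_one rfl rfl
  have h1 : (∑ a : Fin (n3 1), (if π 1 a ∈ P3 1 then d 1 a else -d 1 a)) = ∑ a : Fin 4, (if oc π a = 0 then rd1 d a else -rd1 d a) := by
    show (∑ a : Fin 4, (if oc π a ∈ lowPos 4 1 then rd1 d a else -rd1 d a)) = _
    exact Finset.sum_congr rfl fun a _ => if_congr mem_lowPos_one rfl rfl
  have h2 : (∑ a : Fin (n3 2), (if π 2 a ∈ P3 2 then d 2 a else -d 2 a)) =
      ∑ b : Fin 5, (if (dc π b = 0 ∨ dc π b = 1) then rd2 d b else -rd2 d b) := by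
    show (∑ b : Fin 5, (if dc π b ∈ lowPos 5 2 then rd2 d b else -rd2 d b)) = _
    exact Finset.sum_congr rfl fun a _ => if_congr mem_lowPos_two rfl rfl
  rw [h0, h1, h2]

/-! ### The defect law -/

section Defect

variable {R : Finset (PermsG n3)}

/-- Rotation-stability iterates: `(π₁, π₂, π₃ ρʲ) ∈ R` for all `j`. [folklore] -/
theorem mem_of_rot3 (g : Equiv.Perm (Fin 5)) (hrot : ∀ π ∈ R, withDc π (dc π * (g * finRotate 5 * g⁻¹)) ∈ R)
    {π : PermsG n3} (hπ : π ∈ R) (j : ℕ) : withDc π (dc π * (g * finRotate 5 * g⁻¹) ^ j) ∈ R := by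
  induction j with
  | zero =>
    rw [pow_zero, mul_one, withDc_dc]
    exact hπ
  | succ j ih =>
    have h := hrot _ ih
    rw [dc_withDc, withDc_withDc, mul_assoc, ← pow_succ] at h
    exact h

/-- **THE DEFECT LAW (integer form) for three fields `6 + 8 + 10`.**  If `e` and `d` satisfy the signed equation at every tuple of a set `R` that
is stable under right translation of the decic component by a conjugate rotation (`hrot`) and moves every (sextic pair, octic pair) to `(0, 0)`
(`hjt`), then `d_m ≡ t_m` are constant and `e = t₁ + 2t₂ + t₃`. [cite: MoonenZarhin1995Duke, Thm. 2.4] [cite: GaoUllmo2025, Thm 3.1] -/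
theorem defect3_of_signed (g : Equiv.Perm (Fin 5)) (hrot : ∀ π ∈ R, withDc π (dc π * (g * finRotate 5 * g⁻¹)) ∈ R)
    (hjt : ∀ (x : Fin 3) (y : Fin 4), ∃ π ∈ R, sx π x = 0 ∧ oc π y = 0)
    {e : ℤ} {d : ∀ m : Fin 3, Fin (n3 m) → ℤ}
    (h : ∀ π ∈ R, e + ∑ m : Fin 3, ∑ a : Fin (n3 m), (if π m a ∈ P3 m then d m a else -d m a) = 0) :
    ∃ t : Fin 3 → ℤ, (∀ (m : Fin 3) (a : Fin (n3 m)), d m a = t m) ∧ e = ∑ m : Fin 3, (c3 m : ℤ) * t m := by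
  -- concrete names
  set d₁ : Fin 3 → ℤ := rd0 d with hd₁
  set d₂ : Fin 4 → ℤ := rd1 d with hd₂
  set d₃ : Fin 5 → ℤ := rd2 d with hd₃
  have h' : ∀ π ∈ R, e + ((∑ a : Fin 3, (if sx π a = 0 then d₁ a else -d₁ a)) +
      (∑ a : Fin 4, (if oc π a = 0 then d₂ a else -d₂ a)) +
        ∑ b : Fin 5, (if (dc π b = 0 ∨ dc π b = 1) then d₃ b else -d₃ b)) = 0 := by
    intro π hπ
    have h1 := h π hπ
    rw [sum3_eq] at h1
    exact h1
  -- a base tuple, the frame `u = d₃ ∘ g`, the two positions `p, q` of `π' = π₃ g`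
  obtain ⟨π₀, hπ₀, -⟩ := hjt 0 0
  set π₃ : Equiv.Perm (Fin 5) := dc π₀ with hπ₃
  set u : Fin 5 → ℤ := fun c => d₃ (g c) with hu
  have hp : (π₃ * g) ((π₃ * g).symm 0) = 0 := (π₃ * g).apply_symm_apply 0
  have hq : (π₃ * g) ((π₃ * g).symm 1) = 1 := (π₃ * g).apply_symm_apply 1
  have hpq : (π₃ * g).symm 0 ≠ (π₃ * g).symm 1 := fun hh => by
    have h'' := congrArg (π₃ * g) hh
    rw [hp, hq] at h''
    exact absurd h'' (by decide)
  -- the equations along the rotation: only the decic sums move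
  have hrotj : ∀ j : Fin 5, e + ((∑ a : Fin 3, (if sx π₀ a = 0 then d₁ a else -d₁ a)) +
      (∑ a : Fin 4, (if oc π₀ a = 0 then d₂ a else -d₂ a)) +
        ∑ b : Fin 5, (if ((π₃ * (g * finRotate 5 * g⁻¹) ^ (j : ℕ)) b = 0 ∨ (π₃ * (g * finRotate 5 * g⁻¹) ^ (j : ℕ)) b = 1)
          then d₃ b else -d₃ b)) = 0 := by
    intro j
    have h1 := h' _ (mem_of_rot3 g hrot hπ₀ (j : ℕ))
    rw [sx_withDc, oc_withDc, dc_withDc] at h1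
    exact h1
  have hS : ∀ j : Fin 5, u ((π₃ * g).symm 0 - j) + u ((π₃ * g).symm 1 - j) = u ((π₃ * g).symm 0) + u ((π₃ * g).symm 1) := by
    intro j
    have h0 := hrotj 0
    have hj := hrotj j
    rw [sum_ite_rot_pow_eq π₃ g d₃ 0 hp hq, sub_zero, sub_zero] at h0
    rw [sum_ite_rot_pow_eq π₃ g d₃ j hp hq] at hj
    simp only [hu]
    linarith
  -- hence `d₃` is constant
  have huc : ∀ c, u c = u ((π₃ * g).symm 0) := const_of_pairSums hpq hS
  set t₃ : ℤ := d₃ (g ((π₃ * g).symm 0)) with ht₃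
  have hd₃c : ∀ b, d₃ b = t₃ := fun b => by
    have h1 := huc (g.symm b)
    simp only [hu, Equiv.apply_symm_apply] at h1
    exact h1
  -- the decic part of every equation is `−t₃`
  have hB : ∀ σ : Equiv.Perm (Fin 5), (∑ b : Fin 5, (if (σ b = 0 ∨ σ b = 1) then d₃ b else -d₃ b)) = -t₃ := by
    intro σ
    rw [sum_ite_pair_eq σ (σ.apply_symm_apply 0) (σ.apply_symm_apply 1) d₃, Finset.sum_congr rfl fun b _ => hd₃c b,
      hd₃c (σ.symm 0), hd₃c (σ.symm 1), Finset.sum_const, Finset.card_univ, Fintype.card_fin]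
    ring
  -- the equation at a tuple moving `(x, y)` to `(0, 0)`
  have heq : ∀ (x : Fin 3) (y : Fin 4), e + (2 * d₁ x - ∑ a, d₁ a) + (2 * d₂ y - ∑ a, d₂ a) - t₃ = 0 := by
    intro x y
    obtain ⟨π, hπ, hx, hy⟩ := hjt x y
    have h1 := h' π hπ
    rw [sum_ite_perm_eq (sx π) hx d₁, sum_ite_perm_eq (oc π) hy d₂, hB (dc π)] at h1
    linarith
  have hd₁c : ∀ a, d₁ a = d₁ 0 := fun a => by have h1 := heq a 0; have h2 := heq 0 0; linarith
  have hd₂c : ∀ a, d₂ a = d₂ 0 := fun a => by have h1 := heq 0 a; have h2 := heq 0 0; linarith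
  refine ⟨![d₁ 0, d₂ 0, t₃], fun m => ?_, ?_⟩
  · refine Fin.cases ?_ (fun m => Fin.cases ?_ (fun m => Fin.cases ?_ (fun m => m.elim0) m) m) m
    · exact fun a => hd₁c a
    · exact fun a => hd₂c a
    · exact fun a => hd₃c a
  · have hs₁ : ∑ a, d₁ a = 3 * d₁ 0 := by
      rw [Finset.sum_congr rfl fun a _ => hd₁c a, Finset.sum_const, Finset.card_univ, Fintype.card_fin]; ring
    have hs₂ : ∑ a, d₂ a = 4 * d₂ 0 := by
      rw [Finset.sum_congr rfl fun a _ => hd₂c a, Finset.sum_const, Finset.card_univ, Fintype.card_fin]; ring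
    have h3 := heq 0 0
    rw [hs₁, hs₂] at h3
    rw [Fin.sum_univ_three]
    show e = ((1 : ℕ) : ℤ) * d₁ 0 + ((2 : ℕ) : ℤ) * d₂ 0 + ((1 : ℕ) : ℤ) * t₃
    push_cast
    linarith

end Defect

/-! ### The defect law for configurations -/

section Config

variable {α : Type*} {R : Finset (PermsG n3)} {v : α → PtG n3}

/-- **THE DEFECT LAW FOR CONFIGURATIONS (three fields `6 + 8 + 10`).**  An `R`-balanced configuration, `R` rotation-stable on the decic pairs and
jointly transitive on (sextic pair, octic pair), obeys the defect law of the generic model with curve multiplicities `c3 = (1, 2, 1)` — the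
hypothesis `hdef` of `MultiFieldWeil.hodgeConjectureFor_biproduct_comp_of_defectLawG`. [cite: MoonenZarhin1995Duke, Thm. 2.4] [cite: GaoUllmo2025, Thm 3.1] -/
theorem exists_hasDefectsG_of_modelBalancedG3 (g : Equiv.Perm (Fin 5))
    (hrot : ∀ π ∈ R, withDc π (dc π * (g * finRotate 5 * g⁻¹)) ∈ R)
    (hjt : ∀ (x : Fin 3) (y : Fin 4), ∃ π ∈ R, sx π x = 0 ∧ oc π y = 0)
    {T : Finset α} (hT : ModelBalancedG P3 R v T) : ∃ t : Fin 3 → ℤ, HasDefectsG c3 v T t := by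
  obtain ⟨t, hd, he⟩ := defect3_of_signed g hrot hjt (e := (cnt v T (Sum.inl true) : ℤ) - cnt v T (Sum.inl false))
    (d := fun m a => (cnt v T (Sum.inr ⟨m, (a, true)⟩) : ℤ) - cnt v T (Sum.inr ⟨m, (a, false)⟩))
    fun π hπ => signed_of_modelBalancedG R v hT hπ
  exact ⟨t, fun m a => hd m a, he⟩

/-- **Balanced under such an `R` ⟹ balanced under every set of tuples** (the defect law does not see `R`). [folklore] -/
theorem modelBalancedG3_of_rot (g : Equiv.Perm (Fin 5))
    (hrot : ∀ π ∈ R, withDc π (dc π * (g * finRotate 5 * g⁻¹)) ∈ R)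
    (hjt : ∀ (x : Fin 3) (y : Fin 4), ∃ π ∈ R, sx π x = 0 ∧ oc π y = 0)
    {T : Finset α} (hT : ModelBalancedG P3 R v T) (R' : Finset (PermsG n3)) : ModelBalancedG P3 R' v T := by
  obtain ⟨t, ht⟩ := exists_hasDefectsG_of_modelBalancedG3 g hrot hjt hT
  exact modelBalancedG_of_hasDefects n3_eq ht R'

end Config

end Summit.HodgeConjecture.CorCM.Census.SexticOcticDecicWeil
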